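import Summits.QuantumFields.YangMills.Theorems.BalabanUVNodesN16PinnedLooseMatchOfReg910Slot
import Summits.QuantumFields.YangMills.Theorems.BalabanUVNodesN16ShapeKnit
import HarnessLib

/-!
# Route «BalabanUVNodes», crux K3⁸ `SpineGivenEndpointR13SepCoPHV` (stmt-QuantumFields-27366; K3⁷ 20544 aside), node N16 = NE3: THE (β16) PRODUCER OF THE THREE N16
# CONJUNCTS WITH NODE N19′'s RADII ROWS BUILT IN — the located (t-N16b) JUNCTION CONFLICT (dag-n21-w6 LOCATED-4, `…N21N16bSqueezeAtN19Rows` p614571; ref-Q READ-41)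
# answered PRODUCER-SIDE (option (i)): letters RE-CHOSEN inside THE END's tolerance by LETTER TRANSPORT, radius letter raised by ANTITONICITY — kernel bookkeeping, no estimate

Cell `pub-ymgap`, seat `pub-ymgap-dag-n16-e` (R134 acceleration seat (a), strategy s2 = BY-NAME KNIT at the record; HUMAN RULING D-0062; chair R424 venue), generation 17,
module 49 (THEOREMS ONLY, 0 `def`, 0 `sorry`, standard axioms).  `--kind proof --supports stmt-QuantumFields-27366 --as helper` (count-neutral; proves NO registered stub; KEY
MAP v2: K3-face filings key the K3⁸ item).  `bears_on: R4∕N16 · edges N05 → N16, N07 → N16 · junction N16 → N19′ ∕ N21 (stub 2)`.  Over module 47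
`…N16PinnedLooseMatchOfReg910Slot` (p615316: the LIVE slot-keyed producer), module 45 `…N16PinnedLooseMatch` (p604267: `looseDom_anti`, `n16HolderAt_anti_dom`), module 43
`…N16PinnedLayer13CoPH` (p600861: the pins and faces), dag-n16-w1's `…N16H7LooseOfReg910SlotFamily.exists_letters_inEndRegimeH_leafSlotHolderAT_of_h5_reg910Slot` (the
per-family letters at the loose object from `h5` and the SLOT KEY), this seat's `N16LeafSlotAllTorus.n16HolderAt_of_inEndRegimeH_leafSlotHolderAT`, dag-n16-c's `…N16ShapeKnit.gradConst_four_pos` — CITED BY NAME, none edited.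

THE LOCATED CONFLICT (numbers; dag-n21-w6 pub-ymgap INBOX l.31622, kernel facts in p614571).  K3's stub 1 asks `∃ ℓ₃ g B, GuardedReadingN16 𝔯 ksel ℓ ℓ₃ g B ∧ …` with
`GuardedReadingN16 := GuardedReading ∧ N16PinnedLoose 𝔯 ℓ₃ B ∧ N16LettersEnd 2 g ℓ₃ ∧ N16RadiusMatch ℓ₃ B` (slot-free; byte-identical in v5 941dddb108cbaacf and v6).  Node
N19′'s link reading at the N16-pinned reading (dag-n19-w3 `…N19RateEdgeHolderD4AtN16PinnedReading` :194–:199, = node N16's OWN `NE3Shape` extraction thresholds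
`classRadius_four` ∕ `thresholds_four`) displays, per tuple, letters `c' t` with the RADII ROWS `R.ne3.g = gradConst 4 c'`, `0 ≤ c'`, `R.ne3.b ≤ t`, `c' ≤ t`,
`2^91·L^17·t ≤ 1`, `2^76·L^12·t ≤ R.ne3.ε`, `4·((ℓ₃ F).ε ∕ B F) ≤ c'`.  p614571: these rows FORCE `2^76·L^12·b ≤ ε` (squeeze) and `2^78·L^12 ≤ B F` (floor), which the letter
recipe of record (`b = min (ε∕2) (1∕(20480·L²))`, `B F = max (C F).B₃ (ε∕b)`, modules 45∕47 over the window lemma) MISSES (`not_squeeze_of_endRecipe`,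
`exists_lettersEnd_radiusMatch_not_squeeze`).  Dichotomy for the plan: (i) producer-side re-choice · (ii) junction-side re-derivation of `classRadius_four` · (iii) key-side
`N16RadiusMatch′`.

WHAT THIS FILE PROVES (kernel) — OPTION (i) COSTS THE PRODUCER NOTHING.  §1 LETTER TRANSPORT: `LeafSlotHolderAT c β` (N16LeafSlotAllTorus :99–:125) reads
`c.L c.Nper c.ε c.Λ₁ c.Λ₂' c.dom` and NOT `c.b ∕ c.g ∕ c.C` (`leafSlotHolderAT_reletter`, `rfl`-level), and THE END's regime `InEndRegimeH` (N16HolderRegime :174) accepts ANY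
`0 ≤ b ≤ ε∕2` and ANY `g > 0` with `constOfRecordH … g ≤ C` (`inEndRegimeH_reletter`).  §2 THE SQUEEZED LETTERS (scalars; `gradConst_four_pos` is dag-n16-c's `…N16ShapeKnit`'s, by name): per family, with `ε > 0` the class radius of the
letters of record and `L = F.L`, `c' := min (ε ∕ (2^76·L^12)) (1 ∕ (2^91·L^17))`, `b := c'`, `g := gradConst 4 c'`, `C := constOfRecordH N L Nper g`, `B := max B₃ (4ε ∕ c')` satisfy
EVERY row above with `t := c'`, v5's MATCH row `0 < B ∧ ε∕B ≤ b`, `B₃ ≤ B`, node N19's `ε∕B ≤ 1∕4`, N21's numeral `20480·L²·b ≤ 1`, and p614571's floor `2^78·L^12 ≤ B`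
(`squeezeLetters_spec`).  §3 ★ THE PRODUCER `exists_letters_n16HolderAtReading_loose_squeeze_of_h5_reg910Slot`: from EXACTLY module 47's displayed in-edges — node N05's `h5`, a
local-gauge shape `G` with the (9)_{β₀=1} interface, constants `C`, the SLOT KEY `hR` — and NO coupling-letter input (the letter `g` is OUTPUT, `g F := gradConst 4 (c' F)`; K3's stub 1
quantifies `∃ g`, and node N19′'s design `R.ne3.g = gradConst 4 c'` is exactly the ℓ²-gradient letter `regular_of_sup` produces from the sup letters `(b, c')`): letters `ℓ₃`, radius
letter `B`, sup letter `c'` with `N16LettersEnd N g ℓ₃`, the MATCH row, `(C F).B₃ ≤ B F ∧ 2^78·L^12 ≤ B F`, ALL radii rows at `t := c' F`, and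
`∀ 𝔯, N16PinnedLoose 𝔯 ℓ₃ B → N16HolderAtReading 𝔯 β` — proof = module 47's (dag-n16-w1's per-family letters at any `g₀ > 0`, here `1`) ∘ §1 transport to the squeezed letters ∘
this seat's closer `n16HolderAt_of_inEndRegimeH_leafSlotHolderAT` at radius `ε ∕ B₃` ∘ antitonicity `looseDom_anti` ∕ `n16HolderAt_anti_dom` down to radius `ε ∕ B` ∘
`n16HolderAtReading_of_pinnedLoose`.  §4 the same with the coupling letter displayed as a function `g` and the row `g F = gradConst 4 (c' F)` (K3-stub-1 shape `∃ ℓ₃ g B`).  §5 the rows READ AT THE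
PINNED CARRIERS `R.ne3` of every tuple (node N19′'s text verbatim at `t := c' F`; necessity half = dag-n21-w6's `radiusFloor_of_guardedReadingN16`, p614571).

PRICE (honest; = dag-n21-w6's caveat to (i)).  The pinned loose data set shrinks to radius `ε∕B ≤ ε ∕ (2^78·L^12)` — near-flat data (K3⁷ v5 header: «`B → ∞` is content-poor
but not vacuous»); the (8)-class radius stays `(C F).B₃ · ε₁` only in the sense `(C F).B₃ ≤ B F`.  Option (ii) (re-deriving node N16's `classRadius_four` so that `B ≈ B₃`
suffices — an estimate) is NOT claimed; option (iii) (displaying the rows in the key) is the planner's.  The two further N19′ rows on node N16's CLASS radius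
(`16·C0·ε ≤ 3`, `40960·L²·ε ≤ 1`) are NOT touched here (the class radius `ε` is not a free letter of the leaf).

HONEST FRAMING.  Kernel bookkeeping by name; no estimate; `h5` (node N05's Thm-4 ∕ Prop-3 bodies at exponent β on the pinned all-torus sub-family) and the slot key `hR`
([Balaban1985Variational] Thm 1 (9)–(10) at leaf-06's torus objects ON THE SLOT CUBES — node N07's content) are DISPLAYED hypotheses asserted for no family; nothing of
Bałaban asserted or refuted; no stub of K3⁸ ∕ K3⁷ closed; N16 ∕ N07 ∕ N19 ∕ N21 NOT discharged; the skeletons (v5 on 20544, v6 for 27366) are the planner's and are NOT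
edited; counts UNMOVED (typed 28∕28 · discharged 5∕27, A 5∕28); one finite four-torus at fixed ε — NOT ℝ⁴ ∕ infinite volume ∕ OS ∕ mass gap ∕ Clay.
-/

set_option autoImplicit false

open scoped BigOperators Matrix Matrix.Norms.L2Operator
open NormedSpace

namespace Summit.QuantumFields.YangMills.BalabanUVNodes.N16PinnedLooseMatchSqueeze

open Literature.MathematicalPhysics.QuantumFieldTheory.Balaban1983to89
open Literature.MathematicalPhysics.QuantumFieldTheory.Balaban1983to89.T4Continuum (T4Family ULoop)
open B7Prop1Explicit B7Prop2Explicit MatrixLog UnitaryModel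
open T4AveragingDeficitWall hiding Site Plaq Bond
open B7Prop3Flat (c3)
open B8LeafModelZd (ZdIdx)
open B8LeafModelZd3 (zdGF3)
open Node00 (Stage13HParams NE3Objects₁₁ NE3Letters₁₁ ne3ConstLayerOfRecord₁₁ ne3NperOfRecord₁₁ ne3DomOfRecord₁₁ MatA)
open Summit.QuantumFields.BalabanUV.T4Continuum
open MinimalActionSandwich (IsMinimiser)
open MinimalActionRate (sfClass)
open MinimalActionRefine (gradConst)
open MinimalActionDictionary (torusVP RadiiMono)
open AveragingDeficitLatticeH2Prep (fd)
open B11 (Regularity)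
open YMDAG.UVSplit (NE3Carriers ne3OfRecord₁₁ RateReading₁₃CoPH rateCarriersOfRecord₁₃CoPH)
open Summit.QuantumFields.YangMills.BalabanUVNodes.N16HolderDefs (N16HolderAt)
open Summit.QuantumFields.YangMills.BalabanUVNodes.N16HolderRegime (InEndRegimeH radiusOfRecordH constOfRecordH)
open Summit.QuantumFields.YangMills.BalabanUVNodes.N16LeafSlotAllTorus (LeafSlotHolderAT n16HolderAt_of_inEndRegimeH_leafSlotHolderAT)
open Summit.QuantumFields.YangMills.BalabanUVNodes.N16H7LooseOfReg910SlotFamily (exists_letters_inEndRegimeH_leafSlotHolderAT_of_h5_reg910Slot)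
open Summit.QuantumFields.YangMills.BalabanUVNodes.N16PinnedLayer13CoPH (N16PinnedLoose N16LettersEnd N16HolderAtReading n16HolderAtReading_of_pinnedLoose
  rateCarriers_ne3_of_pinnedLoose)
open Summit.QuantumFields.YangMills.BalabanUVNodes.N16PinnedLooseMatch (n16HolderAt_anti_dom looseDom_anti)
open Summit.QuantumFields.YangMills.BalabanUVNodes.N16 (gradConst_four_pos)

noncomputable section

variable {N : ℕ} [NeZero N]

/-! ## §1 Letter transport: the leaf slot reads no `b ∕ g ∕ C`; THE END's regime takes any `0 ≤ b ≤ ε∕2`, any `g > 0` with its constant -/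

omit [NeZero N] in
/-- **THE LEAF β-SLOT DOES NOT READ THE LETTERS `b`, `g`, `C`** (`LeafSlotHolderAT c β` mentions `c.L`, `c.Nper`, `c.ε`, `c.Λ₁`, `c.Λ₂'`, `c.dom` only): re-lettering an NE3
object in those three fields transports the slot (definitional). [folklore] -/
theorem leafSlotHolderAT_reletter (F : T4Family) (o : NE3Objects₁₁ N) (b g C : ℝ) {β : ℝ} (h : LeafSlotHolderAT (ne3OfRecord₁₁ F o) β) :
    LeafSlotHolderAT (ne3OfRecord₁₁ F { o with b := b, g := g, C := C }) β :=
  h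

/-- **THE END's REGIME UNDER RE-LETTERING**: `InEndRegimeH` (`… ∧ 0 < c.g ∧ … ∧ 0 ≤ c.b ∧ c.b ≤ c.ε∕2 ∧ constOfRecordH N c.L c.Nper c.g ≤ c.C`; it does not read `c.dom`,
module 43 `inEndRegimeH_loose_iff`) survives replacing `(b, g, C)` by any `0 ≤ b' ≤ ε∕2`, `g' > 0`, `C' ≥ constOfRecordH N L Nper g'`, at any data set `D`. [folklore] -/
theorem inEndRegimeH_reletter (F : T4Family) (o : NE3Objects₁₁ N) {b g C : ℝ} (D : Set ((Fin 4 → ℤ) → Fin 4 → (MatA N)ˣ))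
    (h : InEndRegimeH (ne3OfRecord₁₁ F o)) (hg : 0 < g) (hb0 : 0 ≤ b) (hb : b ≤ o.ε / 2) (hC : constOfRecordH N F.L o.Nper g ≤ C) :
    InEndRegimeH (ne3OfRecord₁₁ F { o with b := b, g := g, C := C, dom := D }) :=
  ⟨h.1, h.2.1, hg, h.2.2.2.1, h.2.2.2.2.1, h.2.2.2.2.2.1, h.2.2.2.2.2.2.1, hb0, hb, hC⟩

/-! ## §2 The squeezed letters (scalars): `c' := min (ε∕(2^76·L^12)) (1∕(2^91·L^17))`, `b := c'`, `B := max B₃ (4ε∕c')` meet every radii row with `t := c'` -/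

/-- **THE SQUEEZED LETTERS MEET EVERY ROW** (`1 ≤ L`, `0 < ε`, `0 < B₃`; `c' := min (ε∕(2^76·L^12)) (1∕(2^91·L^17))`, `B := max B₃ (4ε∕c')`): `0 < c'`, the radii rows
`2^91·L^17·c' ≤ 1`, `2^76·L^12·c' ≤ ε`, THE END's tolerance `c' ≤ ε∕2`, N21's numeral `512·5·8·L²·c' ≤ 1`, then `0 < B`, `B₃ ≤ B`, the MATCH row `ε∕B ≤ c'`, node N19's
`ε∕B ≤ 1∕4`, `4·(ε∕B) ≤ c'`, and the FLOOR `2^78·L^12 ≤ B`. [bookkeeping] -/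
theorem squeezeLetters_spec {L ε B₃ : ℝ} (hL : 1 ≤ L) (hε : 0 < ε) (hB₃ : 0 < B₃) :
    0 < min (ε / ((2 : ℝ) ^ 76 * L ^ 12)) (1 / ((2 : ℝ) ^ 91 * L ^ 17)) ∧
    (2 : ℝ) ^ 91 * L ^ 17 * min (ε / ((2 : ℝ) ^ 76 * L ^ 12)) (1 / ((2 : ℝ) ^ 91 * L ^ 17)) ≤ 1 ∧
    (2 : ℝ) ^ 76 * L ^ 12 * min (ε / ((2 : ℝ) ^ 76 * L ^ 12)) (1 / ((2 : ℝ) ^ 91 * L ^ 17)) ≤ ε ∧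
    min (ε / ((2 : ℝ) ^ 76 * L ^ 12)) (1 / ((2 : ℝ) ^ 91 * L ^ 17)) ≤ ε / 2 ∧
    512 * (4 + 1) * (4 + 4) * L ^ 2 * min (ε / ((2 : ℝ) ^ 76 * L ^ 12)) (1 / ((2 : ℝ) ^ 91 * L ^ 17)) ≤ 1 ∧
    0 < max B₃ (4 * ε / min (ε / ((2 : ℝ) ^ 76 * L ^ 12)) (1 / ((2 : ℝ) ^ 91 * L ^ 17))) ∧
    B₃ ≤ max B₃ (4 * ε / min (ε / ((2 : ℝ) ^ 76 * L ^ 12)) (1 / ((2 : ℝ) ^ 91 * L ^ 17))) ∧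
    ε / max B₃ (4 * ε / min (ε / ((2 : ℝ) ^ 76 * L ^ 12)) (1 / ((2 : ℝ) ^ 91 * L ^ 17))) ≤
      min (ε / ((2 : ℝ) ^ 76 * L ^ 12)) (1 / ((2 : ℝ) ^ 91 * L ^ 17)) ∧
    ε / max B₃ (4 * ε / min (ε / ((2 : ℝ) ^ 76 * L ^ 12)) (1 / ((2 : ℝ) ^ 91 * L ^ 17))) ≤ 1 / 4 ∧
    4 * (ε / max B₃ (4 * ε / min (ε / ((2 : ℝ) ^ 76 * L ^ 12)) (1 / ((2 : ℝ) ^ 91 * L ^ 17)))) ≤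
      min (ε / ((2 : ℝ) ^ 76 * L ^ 12)) (1 / ((2 : ℝ) ^ 91 * L ^ 17)) ∧
    (2 : ℝ) ^ 78 * L ^ 12 ≤ max B₃ (4 * ε / min (ε / ((2 : ℝ) ^ 76 * L ^ 12)) (1 / ((2 : ℝ) ^ 91 * L ^ 17))) := by
  set c' := min (ε / ((2 : ℝ) ^ 76 * L ^ 12)) (1 / ((2 : ℝ) ^ 91 * L ^ 17)) with hc'_def
  have hL0 : 0 < L := lt_of_lt_of_le one_pos hL
  have hK : 0 < (2 : ℝ) ^ 76 * L ^ 12 := by positivity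
  have hK' : 0 < (2 : ℝ) ^ 91 * L ^ 17 := by positivity
  have hc'0 : 0 < c' := lt_min (div_pos hε hK) (by positivity)
  have hc'1 : c' ≤ ε / ((2 : ℝ) ^ 76 * L ^ 12) := min_le_left _ _
  have hc'2 : c' ≤ 1 / ((2 : ℝ) ^ 91 * L ^ 17) := min_le_right _ _
  -- the two radii rows
  have hrow17 : (2 : ℝ) ^ 91 * L ^ 17 * c' ≤ 1 := by
    calc (2 : ℝ) ^ 91 * L ^ 17 * c' ≤ (2 : ℝ) ^ 91 * L ^ 17 * (1 / ((2 : ℝ) ^ 91 * L ^ 17)) := mul_le_mul_of_nonneg_left hc'2 hK'.le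
      _ = 1 := by field_simp
  have hrow12 : (2 : ℝ) ^ 76 * L ^ 12 * c' ≤ ε := by
    calc (2 : ℝ) ^ 76 * L ^ 12 * c' ≤ (2 : ℝ) ^ 76 * L ^ 12 * (ε / ((2 : ℝ) ^ 76 * L ^ 12)) := mul_le_mul_of_nonneg_left hc'1 hK.le
      _ = ε := by field_simp
  -- THE END's tolerance and N21's numeral
  have hL12 : (1 : ℝ) ≤ L ^ 12 := one_le_pow₀ hL
  have hL15 : (1 : ℝ) ≤ L ^ 15 := one_le_pow₀ hL
  have hc'ε2 : c' ≤ ε / 2 := by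
    refine hc'1.trans (div_le_div_of_nonneg_left hε.le (by norm_num) ?_)
    nlinarith [hL12]
  have hnum : 512 * (4 + 1) * (4 + 4) * L ^ 2 * c' ≤ 1 := by
    have h1 : 512 * (4 + 1) * (4 + 4) * L ^ 2 * c' ≤ 512 * (4 + 1) * (4 + 4) * L ^ 2 * (1 / ((2 : ℝ) ^ 91 * L ^ 17)) :=
      mul_le_mul_of_nonneg_left hc'2 (by positivity)
    have h2 : 512 * (4 + 1) * (4 + 4) * L ^ 2 * (1 / ((2 : ℝ) ^ 91 * L ^ 17)) ≤ 1 := by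
      rw [mul_one_div, div_le_one hK']
      calc (512 : ℝ) * (4 + 1) * (4 + 4) * L ^ 2 = 20480 * L ^ 2 * 1 := by ring
        _ ≤ (2 : ℝ) ^ 91 * L ^ 2 * L ^ 15 := by gcongr; norm_num
        _ = (2 : ℝ) ^ 91 * L ^ 17 := by ring
    exact h1.trans h2
  -- the radius letter
  set B := max B₃ (4 * ε / c') with hB_def
  have h4 : 0 < 4 * ε / c' := by positivity
  have hB0 : 0 < B := lt_max_of_lt_left hB₃
  have hεB : ε / B ≤ c' / 4 := by
    calc ε / B ≤ ε / (4 * ε / c') := div_le_div_of_nonneg_left hε.le h4 (le_max_right _ _)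
      _ = c' / 4 := by field_simp
  have hc'le1 : c' ≤ 1 := by
    refine hc'2.trans ?_
    rw [div_le_one hK']
    have hL17 : (1 : ℝ) ≤ L ^ 17 := one_le_pow₀ hL
    nlinarith [hL17]
  have hfloor : (2 : ℝ) ^ 78 * L ^ 12 ≤ B := by
    refine le_trans ?_ (le_max_right _ _)
    rw [le_div_iff₀ hc'0]
    calc (2 : ℝ) ^ 78 * L ^ 12 * c' = 4 * ((2 : ℝ) ^ 76 * L ^ 12 * c') := by ring
      _ ≤ 4 * ε := by linarith [hrow12]
  refine ⟨hc'0, hrow17, hrow12, hc'ε2, hnum, hB0, le_max_left _ _, ?_, ?_, ?_, hfloor⟩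
  · linarith [hεB, hc'0]
  · linarith [hεB, hc'le1]
  · linarith [hεB]

/-! ## §3 ★ The producer with the radii rows built in (module 47's in-edges; the coupling letter is OUTPUT) -/

section Producer

variable {β : ℝ} (hβ0 : 0 ≤ β) (hβ1 : β ≤ 1)
include hβ0 hβ1

/-- **★ THE PRODUCER OF THE THREE N16 CONJUNCTS WITH NODE N19′'s RADII ROWS** — from node N05's `h5` (37ᴴ's, VERBATIM), a local-gauge shape `G F` monotone in its radii with the
(9)_{β₀=1} interface, constants `C F`, and the SLOT KEY `hR` (Theorem 1's regularity (9)–(10) for every minimiser over `sfClass (B₃ε₁)` with an `ε₁`-loose datum ON THE SLOT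
CUBE about every site — module 47's binders minus the coupling letter): letters `ℓ₃`, a radius letter `B`, and a sup letter `c'` per family with THE END's rows
`N16LettersEnd N (fun F ↦ gradConst 4 (c' F)) ℓ₃`, the MATCH row `0 < B F ∧ (ℓ₃ F).ε ∕ B F ≤ (ℓ₃ F).b`, `(C F).B₃ ≤ B F ∧ 2^78·(F.L)^12 ≤ B F`, node N19′'s radii rows at
`t := c' F` (`(ℓ₃ F).g = gradConst 4 (c' F)`, `0 ≤ c' F`, `0 < c' F`, `(ℓ₃ F).b ≤ c' F`, `2^91·L^17·c' ≤ 1`, `2^76·L^12·c' ≤ ε`, `ε∕B ≤ 1∕4`, `4·(ε∕B) ≤ c'`), and the N16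
conjunct at EVERY reading pinned loose at `ℓ₃, B`.  `(ℓ₃ F).b = c' F`, `B F = max (C F).B₃ (4·(ℓ₃ F).ε ∕ c' F)`.
[cite: Balaban1985Variational, Thm 1 (9)–(10) p.279] [folklore] -/
theorem exists_letters_n16HolderAtReading_loose_squeeze_of_h5_reg910Slot
    (h5 : ∀ F : T4Family, letI : CStarAlgebra (Matrix (Fin N) (Fin N) ℂ) := {}
      ∃ (len : Site 4 → ℝ) (c₁ c₁' B₁' cP C₂ B₀β : ℝ) (inp : B8.B9Inputs),
        (∀ v : Site 4, 0 < len v → 1 ≤ len v) ∧ (∀ μ : Fin 4, len (e μ) = 1) ∧ 0 < B₁' ∧ 5 * ((4 : ℕ) : ℝ) * F.L * inp.B₀ ≤ B₁' ∧ 0 < c₁' ∧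
        (∀ α₀ α₁ : ℝ, 0 < α₀ → 0 < α₁ → α₀ + α₁ ≤ c₁' →
          α₀ + α₁ ≤ c₁ ∧ C0 4 * (2 * α₀) ≤ 1 / 3 ∧ 4 * α₀ ≤ c2' 4 F.L ∧ 16 * (B₁' * (α₀ + α₁)) ≤ 1 ∧
          Real.exp (4 * (800 * (((4 : ℕ) : ℝ) + 1) ^ 2 * (((4 : ℕ) : ℝ) + 4)) * α₀) * (1 + 8 * (131072 * (((4 : ℕ) : ℝ) + 1) ^ 2) * (B₁' * (α₀ + α₁))) ≤ 2 ∧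
          2 * (B₁' * (α₀ + α₁)) ≤ c3 4 F.L ∧ ((4 : ℕ) : ℝ) * F.L * α₁ ≤ 1 / 8 ∧ α₀ ≤ cP ∧ α₁ ≤ cP ∧ B₁' * (α₀ + α₁) ≤ cP ∧
          2 * (B₁' * (α₀ + α₁)) ^ 2 + 20 * ((4 : ℕ) : ℝ) * α₀ * (B₁' * (α₀ + α₁)) + 2 * C₂ * (B₁' * (α₀ + α₁)) ^ 2 ≤ α₀ + α₁) ∧
        B8.Thm4Body c₁ B₁' (fun i : {i : ZdIdx 4 F.L // (∀ j, i.Ω j = Set.univ) ∧ (∀ m j, i.Λs m j = {_y | j = m}) ∧ (∀ m j, i.Λb m j = {_c | j = m}) ∧ i.η = ((F.L : ℝ)⁻¹) ^ i.k} => (zdGF3 (Matrix (Fin N) (Fin N) ℂ) F.L β len i.1).toGFData) ∧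
        B8.Prop3Body cP 4 (F.L : ℝ) C₂ inp B₀β (fun i : {i : ZdIdx 4 F.L // (∀ j, i.Ω j = Set.univ) ∧ (∀ m j, i.Λs m j = {_y | j = m}) ∧ (∀ m j, i.Λb m j = {_c | j = m}) ∧ i.η = ((F.L : ℝ)⁻¹) ^ i.k} => (zdGF3 (Matrix (Fin N) (Fin N) ℂ) F.L β len i.1).toGFData2))
    {G : T4Family → (Site 4 → Fin 4 → (MatA N)ˣ) → Site 4 → ℕ → ℝ → ℝ → ℝ → Prop} (hGm : ∀ F, RadiiMono 4 (G F))
    (hG : ∀ (F : T4Family) (U : Site 4 → Fin 4 → (MatA N)ˣ) (x : Site 4) (K : ℕ) (α₀ α₁ α₂ : ℝ), 2 ≤ K → G F U x K α₀ α₁ α₂ →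
      ∃ (u : Site 4 → (MatA N)ˣ) (a : Site 4 → Fin 4 → MatA N),
        (∀ z, u z ∈ unitaryUnits (MatA N)) ∧
        (∀ (y : Site 4) (τ : Fin 4), l1 (y - x) ≤ 2 → ((gaugeAct u U y τ : (MatA N)ˣ) : MatA N) = exp (a y τ)) ∧
        (∀ (y : Site 4) (τ : Fin 4), l1 (y - x) ≤ 2 → ‖a y τ‖ ≤ α₀) ∧
        (∀ (y : Site 4) (τ i : Fin 4), l1 (y - x) ≤ 1 → ‖fd i (fun z => a z τ) y‖ ≤ α₁) ∧
        (∀ (τ i l : Fin 4), ‖fd i (fd l (fun z => a z τ)) x‖ ≤ α₂))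
    (C : T4Family → B11Thm1.Consts)
    (hR : ∀ (F : T4Family) (k : ℕ) (ε₁ : ℝ), 0 < ε₁ → ε₁ ≤ (C F).a₁ → ∀ (V U : Site 4 → Fin 4 → (MatA N)ˣ), V ∈ sfClass 4 F.L (ne3NperOfRecord₁₁ F 0 0) ε₁ 0 →
      IsMinimiser 4 (sfClass 4 F.L (ne3NperOfRecord₁₁ F 0 0) ((C F).B₃ * ε₁)) F.L (ne3NperOfRecord₁₁ F 0 0) (k + 1) V U →
        ∀ x : Site 4, Regularity (torusVP 4 F.L (ne3NperOfRecord₁₁ F 0 0) (G F) (k + 1)) (C F).B₃ (C F).B₄ ε₁ U (x, F.L ^ (k + 1) - 1 + F.L ^ (k + 1) + 2)) :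
    ∃ (ℓ₃ : T4Family → NE3Letters₁₁) (B c' : T4Family → ℝ), N16LettersEnd N (fun F => gradConst 4 (c' F)) ℓ₃ ∧
      (∀ F : T4Family, 0 < B F ∧ (ℓ₃ F).ε / B F ≤ (ℓ₃ F).b) ∧
      (∀ F : T4Family, (C F).B₃ ≤ B F ∧ (2 : ℝ) ^ 78 * (F.L : ℝ) ^ 12 ≤ B F) ∧
      (∀ F : T4Family, (ℓ₃ F).g = gradConst 4 (c' F) ∧ 0 ≤ c' F ∧ 0 < c' F ∧ (ℓ₃ F).b ≤ c' F ∧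
        (2 : ℝ) ^ 91 * (F.L : ℝ) ^ 17 * c' F ≤ 1 ∧ (2 : ℝ) ^ 76 * (F.L : ℝ) ^ 12 * c' F ≤ (ℓ₃ F).ε ∧
        (ℓ₃ F).ε / B F ≤ 1 / 4 ∧ 4 * ((ℓ₃ F).ε / B F) ≤ c' F) ∧
      ∀ 𝔯 : RateReading₁₃CoPH N, N16PinnedLoose 𝔯 ℓ₃ B → N16HolderAtReading 𝔯 β := by
  -- the letters of record at the loose object of radius `ε ∕ B₃`, from `h5` and the slot key, at the auxiliary coupling letter `1`
  choose ℓ hℓ using fun F => exists_letters_inEndRegimeH_leafSlotHolderAT_of_h5_reg910Slot (N := N) F one_pos (h5 F) (hGm F) (hG F) (C F) (hR F)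
  have hε0 : ∀ F, 0 < (ℓ F).ε := fun F => (hℓ F).2.2.2.2.2.2.1.2.2.2.1
  have hL1 : ∀ F : T4Family, (1 : ℝ) ≤ F.L := fun F => by exact_mod_cast le_trans one_le_two (HistoryFlow.two_le_L F)
  -- the squeezed scalars per family
  have hs := fun F => squeezeLetters_spec (hL1 F) (hε0 F) (C F).B₃_pos
  -- the re-lettered letters and the radius letter
  refine ⟨fun F => ⟨(ℓ F).ε, min ((ℓ F).ε / ((2 : ℝ) ^ 76 * (F.L : ℝ) ^ 12)) (1 / ((2 : ℝ) ^ 91 * (F.L : ℝ) ^ 17)),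
      gradConst 4 (min ((ℓ F).ε / ((2 : ℝ) ^ 76 * (F.L : ℝ) ^ 12)) (1 / ((2 : ℝ) ^ 91 * (F.L : ℝ) ^ 17))),
      constOfRecordH N F.L (ne3NperOfRecord₁₁ F 0 0) (gradConst 4 (min ((ℓ F).ε / ((2 : ℝ) ^ 76 * (F.L : ℝ) ^ 12)) (1 / ((2 : ℝ) ^ 91 * (F.L : ℝ) ^ 17)))),
      (ℓ F).Λ₁, (ℓ F).Λ₂'⟩,
    fun F => max (C F).B₃ (4 * (ℓ F).ε / min ((ℓ F).ε / ((2 : ℝ) ^ 76 * (F.L : ℝ) ^ 12)) (1 / ((2 : ℝ) ^ 91 * (F.L : ℝ) ^ 17))),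
    fun F => min ((ℓ F).ε / ((2 : ℝ) ^ 76 * (F.L : ℝ) ^ 12)) (1 / ((2 : ℝ) ^ 91 * (F.L : ℝ) ^ 17)),
    fun F => ⟨rfl, (hℓ F).2.1, rfl, (hs F).1, (hs F).2.2.2.2.1, (hℓ F).2.2.2.2.2.1, ?_⟩,
    fun F => ⟨(hs F).2.2.2.2.2.1, (hs F).2.2.2.2.2.2.2.1⟩, fun F => ⟨(hs F).2.2.2.2.2.2.1, (hs F).2.2.2.2.2.2.2.2.2.2⟩,
    fun F => ⟨rfl, (hs F).1.le, (hs F).1, le_rfl, (hs F).2.1, (hs F).2.2.1, (hs F).2.2.2.2.2.2.2.2.1, (hs F).2.2.2.2.2.2.2.2.2.1⟩,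
    fun 𝔯 hpin => n16HolderAtReading_of_pinnedLoose β hpin fun F => ?_⟩
  · -- THE END's regime at the re-lettered constant layer (transport of (9b)'s `InEndRegimeH`; the regime does not read the data)
    have hreg := inEndRegimeH_reletter F _ (ne3DomOfRecord₁₁ F N 0 0) (hℓ F).2.2.2.2.2.2.1 (gradConst_four_pos (hs F).1) (hs F).1.le (hs F).2.2.2.1 le_rfl
    exact hreg
  · -- the N16 conjunct: closer at radius `ε ∕ B₃` on the re-lettered loose object, then antitonicity down to radius `ε ∕ B`
    have hreg := inEndRegimeH_reletter F _ {V | V ∈ ne3DomOfRecord₁₁ F N 0 0 ∧ V ∈ sfClass 4 F.L (ne3NperOfRecord₁₁ F 0 0) ((ℓ F).ε / (C F).B₃) 0}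
      (hℓ F).2.2.2.2.2.2.1 (gradConst_four_pos (hs F).1) (hs F).1.le (hs F).2.2.2.1 le_rfl
    have hH := n16HolderAt_of_inEndRegimeH_leafSlotHolderAT hreg hβ0 hβ1 (leafSlotHolderAT_reletter F _ _ _ _ (hℓ F).2.2.2.2.2.2.2)
    have hres := n16HolderAt_anti_dom F (looseDom_anti F (hε0 F).le (C F).B₃_pos (hs F).2.2.2.2.2.2.1) hH
    exact hres

/-! ## §4 The K3-stub-1 shape: the coupling letter displayed as a function `g` with the row `g F = gradConst 4 (c' F)` -/

/-- **★ THE SAME IN K3's STUB-1 SHAPE `∃ ℓ₃ g B`**: letters `ℓ₃`, coupling letter `g`, radius letter `B`, sup letter `c'` with `N16LettersEnd N g ℓ₃`, the MATCH row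
(= v5∕v6's `N16RadiusMatch ℓ₃ B` unfolded), the floor, node N19′'s radii rows at `t := c' F` with `g F = gradConst 4 (c' F)`, and the N16 conjunct at every reading pinned
loose at `ℓ₃, B`. [cite: Balaban1985Variational, Thm 1 (9)–(10) p.279] [folklore] -/
theorem exists_letters_g_n16HolderAtReading_loose_squeeze_of_h5_reg910Slot
    (h5 : ∀ F : T4Family, letI : CStarAlgebra (Matrix (Fin N) (Fin N) ℂ) := {}
      ∃ (len : Site 4 → ℝ) (c₁ c₁' B₁' cP C₂ B₀β : ℝ) (inp : B8.B9Inputs),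
        (∀ v : Site 4, 0 < len v → 1 ≤ len v) ∧ (∀ μ : Fin 4, len (e μ) = 1) ∧ 0 < B₁' ∧ 5 * ((4 : ℕ) : ℝ) * F.L * inp.B₀ ≤ B₁' ∧ 0 < c₁' ∧
        (∀ α₀ α₁ : ℝ, 0 < α₀ → 0 < α₁ → α₀ + α₁ ≤ c₁' →
          α₀ + α₁ ≤ c₁ ∧ C0 4 * (2 * α₀) ≤ 1 / 3 ∧ 4 * α₀ ≤ c2' 4 F.L ∧ 16 * (B₁' * (α₀ + α₁)) ≤ 1 ∧
          Real.exp (4 * (800 * (((4 : ℕ) : ℝ) + 1) ^ 2 * (((4 : ℕ) : ℝ) + 4)) * α₀) * (1 + 8 * (131072 * (((4 : ℕ) : ℝ) + 1) ^ 2) * (B₁' * (α₀ + α₁))) ≤ 2 ∧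
          2 * (B₁' * (α₀ + α₁)) ≤ c3 4 F.L ∧ ((4 : ℕ) : ℝ) * F.L * α₁ ≤ 1 / 8 ∧ α₀ ≤ cP ∧ α₁ ≤ cP ∧ B₁' * (α₀ + α₁) ≤ cP ∧
          2 * (B₁' * (α₀ + α₁)) ^ 2 + 20 * ((4 : ℕ) : ℝ) * α₀ * (B₁' * (α₀ + α₁)) + 2 * C₂ * (B₁' * (α₀ + α₁)) ^ 2 ≤ α₀ + α₁) ∧
        B8.Thm4Body c₁ B₁' (fun i : {i : ZdIdx 4 F.L // (∀ j, i.Ω j = Set.univ) ∧ (∀ m j, i.Λs m j = {_y | j = m}) ∧ (∀ m j, i.Λb m j = {_c | j = m}) ∧ i.η = ((F.L : ℝ)⁻¹) ^ i.k} => (zdGF3 (Matrix (Fin N) (Fin N) ℂ) F.L β len i.1).toGFData) ∧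
        B8.Prop3Body cP 4 (F.L : ℝ) C₂ inp B₀β (fun i : {i : ZdIdx 4 F.L // (∀ j, i.Ω j = Set.univ) ∧ (∀ m j, i.Λs m j = {_y | j = m}) ∧ (∀ m j, i.Λb m j = {_c | j = m}) ∧ i.η = ((F.L : ℝ)⁻¹) ^ i.k} => (zdGF3 (Matrix (Fin N) (Fin N) ℂ) F.L β len i.1).toGFData2))
    {G : T4Family → (Site 4 → Fin 4 → (MatA N)ˣ) → Site 4 → ℕ → ℝ → ℝ → ℝ → Prop} (hGm : ∀ F, RadiiMono 4 (G F))
    (hG : ∀ (F : T4Family) (U : Site 4 → Fin 4 → (MatA N)ˣ) (x : Site 4) (K : ℕ) (α₀ α₁ α₂ : ℝ), 2 ≤ K → G F U x K α₀ α₁ α₂ →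
      ∃ (u : Site 4 → (MatA N)ˣ) (a : Site 4 → Fin 4 → MatA N),
        (∀ z, u z ∈ unitaryUnits (MatA N)) ∧
        (∀ (y : Site 4) (τ : Fin 4), l1 (y - x) ≤ 2 → ((gaugeAct u U y τ : (MatA N)ˣ) : MatA N) = exp (a y τ)) ∧
        (∀ (y : Site 4) (τ : Fin 4), l1 (y - x) ≤ 2 → ‖a y τ‖ ≤ α₀) ∧
        (∀ (y : Site 4) (τ i : Fin 4), l1 (y - x) ≤ 1 → ‖fd i (fun z => a z τ) y‖ ≤ α₁) ∧
        (∀ (τ i l : Fin 4), ‖fd i (fd l (fun z => a z τ)) x‖ ≤ α₂))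
    (C : T4Family → B11Thm1.Consts)
    (hR : ∀ (F : T4Family) (k : ℕ) (ε₁ : ℝ), 0 < ε₁ → ε₁ ≤ (C F).a₁ → ∀ (V U : Site 4 → Fin 4 → (MatA N)ˣ), V ∈ sfClass 4 F.L (ne3NperOfRecord₁₁ F 0 0) ε₁ 0 →
      IsMinimiser 4 (sfClass 4 F.L (ne3NperOfRecord₁₁ F 0 0) ((C F).B₃ * ε₁)) F.L (ne3NperOfRecord₁₁ F 0 0) (k + 1) V U →
        ∀ x : Site 4, Regularity (torusVP 4 F.L (ne3NperOfRecord₁₁ F 0 0) (G F) (k + 1)) (C F).B₃ (C F).B₄ ε₁ U (x, F.L ^ (k + 1) - 1 + F.L ^ (k + 1) + 2)) :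
    ∃ (ℓ₃ : T4Family → NE3Letters₁₁) (g B c' : T4Family → ℝ), (∀ F, 0 < g F) ∧ N16LettersEnd N g ℓ₃ ∧
      (∀ F : T4Family, 0 < B F ∧ (ℓ₃ F).ε / B F ≤ (ℓ₃ F).b) ∧
      (∀ F : T4Family, (C F).B₃ ≤ B F ∧ (2 : ℝ) ^ 78 * (F.L : ℝ) ^ 12 ≤ B F) ∧
      (∀ F : T4Family, g F = gradConst 4 (c' F) ∧ (ℓ₃ F).g = gradConst 4 (c' F) ∧ 0 ≤ c' F ∧ (ℓ₃ F).b ≤ c' F ∧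
        (2 : ℝ) ^ 91 * (F.L : ℝ) ^ 17 * c' F ≤ 1 ∧ (2 : ℝ) ^ 76 * (F.L : ℝ) ^ 12 * c' F ≤ (ℓ₃ F).ε ∧
        (ℓ₃ F).ε / B F ≤ 1 / 4 ∧ 4 * ((ℓ₃ F).ε / B F) ≤ c' F) ∧
      ∀ 𝔯 : RateReading₁₃CoPH N, N16PinnedLoose 𝔯 ℓ₃ B → N16HolderAtReading 𝔯 β := by
  obtain ⟨ℓ₃, B, c', hEnd, hM, hF, hrows, hH⟩ :=
    exists_letters_n16HolderAtReading_loose_squeeze_of_h5_reg910Slot (N := N) hβ0 hβ1 h5 hGm hG C hR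
  exact ⟨ℓ₃, fun F => gradConst 4 (c' F), B, c', fun F => gradConst_four_pos (hrows F).2.2.1, hEnd, hM, hF,
    fun F => ⟨rfl, (hrows F).1, (hrows F).2.1, (hrows F).2.2.2.1, (hrows F).2.2.2.2.1, (hrows F).2.2.2.2.2.1, (hrows F).2.2.2.2.2.2.1, (hrows F).2.2.2.2.2.2.2⟩, hH⟩

end Producer

/-! ## §5 The radii rows READ AT THE PINNED CARRIERS (node N19′'s ∕ N21's form `R.ne3.g = gradConst 4 c'`, `R.ne3.b ≤ t`, …, at `t := c' F`) -/

/-- **THE RADII ROWS AT THE RATE CARRIERS OF A LOOSE-PINNED READING** — under `N16PinnedLoose 𝔯 ℓ₃ B` the carrier `R.ne3` of EVERY tuple and run length IS RR-1's constant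
layer read by `ℓ₃ F` (module 43 `rateCarriers_ne3_of_pinnedLoose`), so §3's per-family rows become node N19′'s seven radii rows VERBATIM
(`…N19RateEdgeHolderD4AtN16PinnedReading` :194–:199 with `t := c' F`): `R.ne3.g = gradConst 4 (c' F)`, `0 ≤ c' F`, `R.ne3.b ≤ c' F`, `c' F ≤ c' F`, `2^91·(R.ne3.L)^17·c' ≤ 1`,
`2^76·(R.ne3.L)^12·c' ≤ R.ne3.ε`, `4·((ℓ₃ F).ε ∕ B F) ≤ c' F` — the necessity half is dag-n21-w6's `…N21N16bSqueezeAtN19Rows.radiusFloor_of_guardedReadingN16` (p614571). [bookkeeping] -/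
theorem radiiRows_rateCarriers_of_pinnedLoose {𝔯 : RateReading₁₃CoPH N} {ℓ₃ : T4Family → NE3Letters₁₁} {B c' : T4Family → ℝ} (hpin : N16PinnedLoose 𝔯 ℓ₃ B)
    (hrows : ∀ F : T4Family, (ℓ₃ F).g = gradConst 4 (c' F) ∧ 0 ≤ c' F ∧ 0 < c' F ∧ (ℓ₃ F).b ≤ c' F ∧
      (2 : ℝ) ^ 91 * (F.L : ℝ) ^ 17 * c' F ≤ 1 ∧ (2 : ℝ) ^ 76 * (F.L : ℝ) ^ 12 * c' F ≤ (ℓ₃ F).ε ∧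
      (ℓ₃ F).ε / B F ≤ 1 / 4 ∧ 4 * ((ℓ₃ F).ε / B F) ≤ c' F)
    (F : T4Family) (θ : Stage13HParams F N) (hP : θ.Provisos₁₃CoPH F N) (g₀ : ℕ → ℝ) (os : List (ULoop F)) (k : ℕ) :
    (rateCarriersOfRecord₁₃CoPH 𝔯 F θ hP g₀ os k).ne3.g = gradConst 4 (c' F) ∧ 0 ≤ c' F ∧
      (rateCarriersOfRecord₁₃CoPH 𝔯 F θ hP g₀ os k).ne3.b ≤ c' F ∧ c' F ≤ c' F ∧
      (2 : ℝ) ^ 91 * ((rateCarriersOfRecord₁₃CoPH 𝔯 F θ hP g₀ os k).ne3.L : ℝ) ^ 17 * c' F ≤ 1 ∧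
      (2 : ℝ) ^ 76 * ((rateCarriersOfRecord₁₃CoPH 𝔯 F θ hP g₀ os k).ne3.L : ℝ) ^ 12 * c' F ≤ (rateCarriersOfRecord₁₃CoPH 𝔯 F θ hP g₀ os k).ne3.ε ∧
      4 * ((ℓ₃ F).ε / B F) ≤ c' F := by
  rw [rateCarriers_ne3_of_pinnedLoose hpin F θ hP g₀ os k]
  exact ⟨(hrows F).1, (hrows F).2.1, (hrows F).2.2.2.1, le_rfl, (hrows F).2.2.2.2.1, (hrows F).2.2.2.2.2.1, (hrows F).2.2.2.2.2.2.2⟩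

end

end Summit.QuantumFields.YangMills.BalabanUVNodes.N16PinnedLooseMatchSqueeze
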